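import Summits.HodgeConjecture.CorCM.Census.CentralSquaresPartnersClasses
import Summits.HodgeConjecture.CorCM.Census.CentralSquaresPartners

/-!
# The square-central class, LVI: THE ALL-DIHEDRAL MULTI-PARTNER LAW — `μ(G, c) = φ₂(G, c)` for a base block all of whose partners are of dihedral type

COR-CM (cell `pub-hodgecm2`), count-neutral kernel combinatorics by the binder seat b09 (gen 50; lane SQUARE-CENTRAL CLASS, part LVI — the capstone of
parts XLIX–LV), assembling BY NAME: part Iʼs strict cover-closure law (`isLeast_card_gfaces_generate_of_strict_cover_closure`), part XLIXʼs multi-partner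
residual closure (`residual_closure_partners_bpot`), and the four relation families at a dihedral-type partner of a multi-partner block — `R(T)` (LI,
`rel_transversal_mem_partners`), `Rᶜ(T')` (LII, `relc_mem_partners`), `2Y_s`, `2Y'_a` (LV, `two_smul_Y_mem_partners`, `two_smul_Y'_mem_partners`).
Theorems only: no definition, no `decide`, no certificate, no named fact, no `sorry`.  HONEST FRAMING: `HC_CM` is NOT proved, here or anywhere in the tree;
nothing here is a period or a headline — these are census laws `μ(G, c)` for the face-relation lattice.

**THE ALL-DIHEDRAL MULTI-PARTNER LAW (`isLeast_card_gfaces_generate_partners_dihedral`).**  Let `G` be a finite `2`-group with a central involution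
`c ≠ 1` and `T₀` a CM type with `|T₀| = 4m`, `m ≥ 3`, whose base changes are exactly `T₀`, `T̄₀`, the types of a nonempty finite set `𝒯` of PARTNERS and
their complements, every partner at distance `2m` from `T₀` and any two partners at distance `2m` from each other (the base block of the rank-`r` affine
frame of a square-central row has `2^r − 1` such partners).  Suppose EVERY partner `T₁ ∈ 𝒯` is of DIHEDRAL TYPE: there is a swap `Q` (`T₀·Q⁻¹ = T₁`,
`Q² = 1`) whose place permutation preserves `𝓗 = T₀ ∖ T₁`, with transversals `T ⊆ 𝓗`, `T' ⊆ T₀ ∩ T₁` of size `m`, such that (ties) at every transversal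
type of `𝓗` resp. of `T₀ ∩ T₁` the only base changes at distance `m` are `T₀, T₁` resp. `T₀, T̄₁`, and (far partners) every other partner and its
complement are strictly farther than `T₀` (resp. `T₁`, `T̄₁`) from the level-`(m + 2)` classes of `T` and of `T'` in the frame and in the companion frame.
Then **`μ(G, c) = φ₂(G, c)`**: the least number of faces whose base changes together with the pairs generate the Hodge lattice is the coinvariant fibre.

For ONE partner this is part VIIIʼs four-type law (there the tie and far hypotheses are automatic).  The hypotheses are those of the rank-two affine block
of `2^{1+4}_+ × E` with `|E| ≥ 2` (all three partners dihedral, `m ≥ 8`, `|T ∩ 𝓗'| = m/2` for the other partners); the instance is the successorʼs file.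
NUMERICS (`HOME/pub-hodgecm2-b09/lean-g50/py/eight*.py`): at `m = 4` (`2^{1+4}_+`, Pauli `× ℤ/2`, order `32`) the far hypotheses fail at some pair types,
yet every lowering cover sampled closes the near lattice (rank `52/52`, index `8`) — the boundary rows need a separate argument, as `m = 2` did in the
four-type theory.

## References
* [Pohlmann1968] H. Pohlmann, Algebraic cycles on abelian varieties of complex multiplication type, Ann. of Math. 88 (1968), Thm 1.
* [Milne1999] J. S. Milne, Lefschetz motives and the Tate conjecture, Compositio Math. 117 (1999), Prop. 2.1, p. 54.
-/

namespace Summit.HodgeConjecture.CorCM.Census.CentralSquares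

open Finset
open scoped symmDiff
open Summit.HodgeConjecture.CorCM.Prior.AllgGroup.RfwfAllgGroup
open Summit.HodgeConjecture.CorCM.Census.BlockParity
open Summit.HodgeConjecture.CorCM.Census.Coinvariant
open Summit.HodgeConjecture.CorCM.Census.TwistGeneration
open Summit.HodgeConjecture.CorCM.Census.BaseBlock
open Summit.HodgeConjecture.CorCM.Census.CoverClosure

noncomputable section

variable {G : Type*} [Group G] [Fintype G] [DecidableEq G] (c : G)

/-- **THE ALL-DIHEDRAL MULTI-PARTNER LAW.**  `G` a finite `2`-group, `c` a central involution `≠ 1`; `T₀` a base type with `|T₀| = 4m`, `m ≥ 3`, whose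
base changes are `T₀`, `T̄₀`, the partners `T₁ ∈ 𝒯 ≠ ∅` and their complements (`|T₀ ∖ T₁| = 2m`, partners pairwise at distance `2m`); every partner of
dihedral type with transversals, ties only with `T₀`/`T₁` (resp. `T₀`/`T̄₁`) at the transversal types, and the other partners far from the level-`(m+2)`
classes.  Then **`μ(G, c) = φ₂(G, c)`**. [folklore] -/
theorem isLeast_card_gfaces_generate_partners_dihedral (hG : IsPGroup 2 G) (hc2 : c * c = 1) (hc1 : c ≠ 1) (hcen : ∀ x : G, x * c = c * x)
    (T₀ : CMF G c) (𝒯 : Finset (CMF G c)) (h𝒯 : 𝒯.Nonempty)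
    (hbase : ∀ Q : G, rt c Q T₀ = T₀ ∨ rt c Q T₀ = rt c c T₀ ∨ ∃ T₁ ∈ 𝒯, rt c Q T₀ = T₁ ∨ rt c Q T₀ = rt c c T₁)
    (m : ℕ) (hm : 3 ≤ m) (hn : T₀.1.card = 4 * m) (hH : ∀ T₁ ∈ 𝒯, (T₀.1 \ T₁.1).card = 2 * m)
    (hpair : ∀ T₁ ∈ 𝒯, ∀ T₂ ∈ 𝒯, T₁ ≠ T₂ → ((T₀.1 \ T₁.1) ∆ (T₀.1 \ T₂.1)).card = 2 * m)
    (hframe : ∀ T₁ ∈ 𝒯, ∃ Q : G, ∃ T T' : Finset G,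
      rt c Q T₀ = T₁ ∧ Q * Q = 1 ∧
      (∀ t ∈ T₀.1, ∀ t' ∈ T₀.1, (t' = t * Q ∨ t' = c * (t * Q)) → (t ∈ T₀.1 \ T₁.1 ↔ t' ∈ T₀.1 \ T₁.1)) ∧
      (T ⊆ T₀.1 \ T₁.1 ∧ T.card = m ∧ ∀ t ∈ T₀.1 \ T₁.1, ∀ t' ∈ T₀.1, (t' = t * Q ∨ t' = c * (t * Q)) → (t ∈ T ↔ t' ∉ T)) ∧
      (T' ⊆ T₀.1 ∩ T₁.1 ∧ T'.card = m ∧ ∀ t ∈ T₀.1 ∩ T₁.1, ∀ t' ∈ T₀.1, (t' = t * Q ∨ t' = c * (t * Q)) → (t ∈ T' ↔ t' ∉ T')) ∧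
      -- ties at the transversal types of `𝓗` and of `T₀ ∩ T₁`
      (∀ U : Finset G, U ⊆ T₀.1 \ T₁.1 → U.card = m →
        (∀ t ∈ T₀.1 \ T₁.1, ∀ t' ∈ T₀.1, (t' = t * Q ∨ t' = c * (t * Q)) → (t ∈ U ↔ t' ∉ U)) →
        ∀ X : CMF G c, T₀.1 \ X.1 = U → ∀ Q' : G, ddist (rt c Q' T₀) X = m → rt c Q' T₀ = T₀ ∨ rt c Q' T₀ = T₁) ∧
      (∀ U' : Finset G, U' ⊆ T₀.1 ∩ T₁.1 → U'.card = m →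
        (∀ t ∈ T₀.1 ∩ T₁.1, ∀ t' ∈ T₀.1, (t' = t * Q ∨ t' = c * (t * Q)) → (t ∈ U' ↔ t' ∉ U')) →
        ∀ X : CMF G c, T₀.1 \ X.1 = U' → ∀ Q' : G, ddist (rt c Q' T₀) X = m → rt c Q' T₀ = T₀ ∨ rt c Q' T₀ = rt c c T₁) ∧
      -- far partners at the level-`(m+2)` classes of `T` (frame and exchanged frame)
      (∀ a ∈ T₀.1 ∩ T₁.1, ∀ a' ∈ T₀.1, (a' = a * Q ∨ a' = c * (a * Q)) →
        (∀ T₂ ∈ 𝒯, T₂ ≠ T₁ → ∀ X : CMF G c, T₀.1 \ X.1 ⊆ T ∪ {a, a'} →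
          (T₀.1 \ X.1).card < ddist T₂ X ∧ (T₀.1 \ X.1).card < ddist (rt c c T₂) X) ∧
        (∀ T₂ ∈ 𝒯, T₂ ≠ T₁ → ∀ X : CMF G c, T₁.1 \ X.1 ⊆ ((T₀.1 \ T₁.1) \ T).image (fun x => c * x) ∪ {a, a'} →
          (T₁.1 \ X.1).card < ddist T₂ X ∧ (T₁.1 \ X.1).card < ddist (rt c c T₂) X)) ∧
      -- far partners at the level-`(m+2)` classes of `T'` (companion frame and its exchange)
      (∀ s ∈ T₀.1 \ T₁.1, ∀ s' ∈ T₀.1, (s' = s * Q ∨ s' = c * (s * Q)) →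
        (∀ T₂ ∈ 𝒯, T₂ ≠ T₁ → ∀ X : CMF G c, T₀.1 \ X.1 ⊆ T' ∪ {s, s'} →
          (T₀.1 \ X.1).card < ddist T₂ X ∧ (T₀.1 \ X.1).card < ddist (rt c c T₂) X) ∧
        (∀ T₂ ∈ 𝒯, T₂ ≠ T₁ → ∀ X : CMF G c,
          (rt c c T₁).1 \ X.1 ⊆ ((T₀.1 \ (rt c c T₁).1) \ T').image (fun x => c * x) ∪ {s, s'} →
          ((rt c c T₁).1 \ X.1).card < ddist T₂ X ∧ ((rt c c T₁).1 \ X.1).card < ddist (rt c c T₂) X))) :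
    IsLeast {n : ℕ | ∃ S : Finset (CMF G c →₀ ℤ), (↑S ⊆ gfaceSet G c hc2) ∧ S.card = n ∧
      hodgeSpan c hc2 ≤ Submodule.span ℤ (pairSet c) ⊔ Submodule.span ℤ (translates c S)} (fibreTwo c hc2) := by
  refine isLeast_card_gfaces_generate_of_strict_cover_closure c T₀ hG hc2 hc1 hcen 1 fun S hS hlow => ?_
  -- the lattice of the cover
  have hP : ∀ Ψ : CMF G c, pair c Ψ ∈ Submodule.span ℤ (pairSet c) ⊔ Submodule.span ℤ (translates c S) :=
    fun Ψ => Submodule.mem_sup_left (Submodule.subset_span (pair_mem_pairSet c Ψ))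
  have hLrt : ∀ (Q' : G) (y : CMF G c →₀ ℤ), y ∈ Submodule.span ℤ (pairSet c) ⊔ Submodule.span ℤ (translates c S) →
      Finsupp.mapDomain (rt c Q') y ∈ Submodule.span ℤ (pairSet c) ⊔ Submodule.span ℤ (translates c S) :=
    fun Q' y hy => mapDomain_rt_mem_psp c hcen Q' S hy
  have hcover : ∀ Ψ : CMF G c, 2 ≤ bpot c T₀ Ψ → ∃ Q₂ s s' : G, bpot c T₀ Ψ = ddist (rt c Q₂ T₀) Ψ ∧
      s ∈ (rt c Q₂ T₀).1 \ Ψ.1 ∧ s' ∈ (rt c Q₂ T₀).1 \ Ψ.1 ∧ s ≠ s' ∧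
      gface c hc2 Ψ s s' ∈ Submodule.span ℤ (pairSet c) ⊔ Submodule.span ℤ (translates c S) ∧
      ((∃ Q₁ t t' : G, bpot c T₀ Ψ = ddist (rt c Q₁ T₀) Ψ ∧ t ∈ (rt c Q₁ T₀).1 \ Ψ.1 ∧ t' ∈ (rt c Q₁ T₀).1 \ Ψ.1 ∧ t ≠ t' ∧
          (∀ Q' : G, ddist (rt c Q' T₀) (oflipCM c hc2 t Ψ) = bpot c T₀ (oflipCM c hc2 t Ψ) → rt c Q' T₀ = rt c Q₁ T₀) ∧
          (∀ Q' : G, ddist (rt c Q' T₀) (oflipCM c hc2 t' Ψ) = bpot c T₀ (oflipCM c hc2 t' Ψ) → rt c Q' T₀ = rt c Q₁ T₀) ∧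
          (∀ Q' : G, ddist (rt c Q' T₀) (oflipCM c hc2 t (oflipCM c hc2 t' Ψ)) = bpot c T₀ (oflipCM c hc2 t (oflipCM c hc2 t' Ψ)) →
            rt c Q' T₀ = rt c Q₁ T₀)) →
        (∀ Q' : G, ddist (rt c Q' T₀) (oflipCM c hc2 s Ψ) = bpot c T₀ (oflipCM c hc2 s Ψ) → rt c Q' T₀ = rt c Q₂ T₀) ∧
        (∀ Q' : G, ddist (rt c Q' T₀) (oflipCM c hc2 s' Ψ) = bpot c T₀ (oflipCM c hc2 s' Ψ) → rt c Q' T₀ = rt c Q₂ T₀) ∧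
        (∀ Q' : G, ddist (rt c Q' T₀) (oflipCM c hc2 s (oflipCM c hc2 s' Ψ)) = bpot c T₀ (oflipCM c hc2 s (oflipCM c hc2 s' Ψ)) →
          rt c Q' T₀ = rt c Q₂ T₀)) := fun Ψ h2 => by
    obtain ⟨Q₂, s, s', hQ₂, hs, hs', hss', hmem, hstr⟩ := hlow Ψ h2
    exact ⟨Q₂, s, s', hQ₂, hs, hs', hss', Submodule.mem_sup_right hmem, hstr⟩
  have hHc : ∀ T₁ ∈ 𝒯, (T₀.1 ∩ T₁.1).card = 2 * m := by
    intro T₁ hT₁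
    have h0 := card_sdiff_add_card_inter T₀.1 T₁.1
    have h1 := hH T₁ hT₁
    omega
  refine residual_closure_partners_bpot c hc2 hc1 hcen T₀ 𝒯 h𝒯 hbase _ hP 1 m hH hHc ?_ ?_ ?_ ?_
  · -- `2Y_s`
    intro T₁ hT₁ s hs
    obtain ⟨Q, T, T', hQ, hQQ, hσH, ⟨hTH, hTm, hT⟩, ⟨hTH', hTm', hT'⟩, hties, htiesC, hfarT, hfarT'⟩ := hframe T₁ hT₁
    rw [pow_one]
    exact two_smul_Y_mem_partners c hc2 hcen T₀ 𝒯 hbase m hn hH hpair T₁ hT₁ Q hQ hQQ hσH _ hLrt hP hcover hties htiesC hm T hTH hTm hT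
      T' hTH' hTm' hT' hfarT' s hs
  · -- `2Y'_a`
    intro T₁ hT₁ a ha
    obtain ⟨Q, T, T', hQ, hQQ, hσH, ⟨hTH, hTm, hT⟩, ⟨hTH', hTm', hT'⟩, hties, htiesC, hfarT, hfarT'⟩ := hframe T₁ hT₁
    rw [pow_one]
    exact two_smul_Y'_mem_partners c hc2 hcen T₀ 𝒯 hbase m hn hH hpair T₁ hT₁ Q hQ hQQ hσH _ hLrt hP hcover hties htiesC hm T hTH hTm hT
      T' hTH' hTm' hT' hfarT a ha
  · -- `R(T)`
    intro T₁ hT₁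
    obtain ⟨Q, T, T', hQ, hQQ, hσH, ⟨hTH, hTm, hT⟩, ⟨hTH', hTm', hT'⟩, hties, htiesC, hfarT, hfarT'⟩ := hframe T₁ hT₁
    exact ⟨T, hTH, hTm, rel_transversal_mem_partners c hc2 hcen T₀ 𝒯 hbase m hn hH hpair T₁ hT₁ Q hQ hQQ _ hLrt hcover (by omega) hσH T hTH hTm hT
      (hties T hTH hTm hT)⟩
  · -- `Rᶜ(T')`
    intro T₁ hT₁
    obtain ⟨Q, T, T', hQ, hQQ, hσH, ⟨hTH, hTm, hT⟩, ⟨hTH', hTm', hT'⟩, hties, htiesC, hfarT, hfarT'⟩ := hframe T₁ hT₁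
    exact relc_mem_partners c hc2 hcen T₀ 𝒯 hbase m hn hH hpair T₁ hT₁ Q hQ hQQ hσH _ hLrt hcover htiesC hP (by omega) ⟨T', hTH', hTm', hT'⟩

end

end Summit.HodgeConjecture.CorCM.Census.CentralSquares
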